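import Literature.AnabelianGeometry.SemiGraphs.SubgraphComponentsDoubleCosetsOfStabilizers
import Literature.AnabelianGeometry.SemiGraphs.DecompositionGroupGeneral
import HarnessLib

/-!
# (D3) `covering_subgraphComponents_doubleCosets` for an ABSTRACT covering, reduced to ONE inclusion
([SemiAnbd] Cor. 2.7 (i), p. 30; Rem. 2.2.1 p. 24)

Mochizuki, *Semi-graphs of anabelioids*, Publ. RIMS **42** (2006), §2, proof of Corollary 2.7 (i),
author's manuscript p. 30 [cite: MochizukiSemiAnbd2006, Cor. 2.7(i) p.30]; Remark 2.2.1 p. 24 (images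
of fundamental groups along a finite étale covering are decomposition groups = stabilizers).

abc-iut cell, layer L3, FACT-LIST row F-1487 (abstract-`φ` form of the dictionary item (D3) of
`FiniteEtaleCoveringDictionary.lean`, abc-iut-L3-d3).  PROOF-ONLY file (no definition, no new named
fact).  State of the tree: (D3) holds at the covering of record `𝒢_A → 𝒢`
(`subgraphComponents_doubleCosets_coveringHomCan`, abc-iut-w6-d036), and for an ARBITRARY morphism it is
reduced to the «matched stabilizers» input (ST) of abc-iut-w5-d041
(`covering_subgraphComponents_doubleCosets_of_stabilizers`): at every vertex `w″` of every preimage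
component `K` of `ℍ` SOME point `a` of the fibre of `A` with BOTH `ι_ψ(Π_K) = Stab_{Π_ℍ}(a)`
(`ψ := φ|_K : 𝒢′|_K → 𝒢|_ℍ`) AND `ι″(Π_{𝒢′}) = Stab_{Π_𝒢}(a)`.

This file shows that two thirds of (ST) are ALREADY consequences of the hypotheses of the abstract
fact, and isolates the exact remainder:

* the matching point is supplied by the GLOBAL clause alone — abc-iut-w4-d071's
  `covering_decompositionGroup_of_isGlobalCoveringOf` ((D1) without connectedness) produces, at the
  constituent basepoints `(F″, F₂, e₂)` through `w″`, a point `x₀` (the fibre point of the diagonal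
  section `A → A × A` read through `α : B(𝒢)_{/A} ⥲ B(𝒢′)`) with `ι″(Π_{𝒢′}) = Stab_{Π_𝒢}(x₀)` — the
  second equation of (ST);
* the inclusion `ι_ψ(Π_K) ≤ Stab_{Π_ℍ}(x₀)` is abc-iut-L6-t17's bridge
  (`pi1Map_pullbackFunctor_comp_piHToPi`: `Π_K → Π_{𝒢′} → Π_𝒢` factors through `Π_K → Π_ℍ → Π_𝒢`, and
  `Π_ℍ` acts on the fibre of `A|_ℍ` through `Π_ℍ → Π_𝒢`) — `range_restrict_le_stabilizer_of_range_le`;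
* so (ST), hence (D3) for an arbitrary local ∧ global ∧ vertex-aligned `φ`, follows from the SINGLE
  INCLUSION (Surj) «`Stab_{Π_ℍ}(x) ≤ ι_ψ(Π_K)` for every point `x` of the fibre of `A` fixed by the
  decomposition group `ι″(Π_{𝒢′})`» — `covering_subgraphComponents_doubleCosets_of_restrictSurjective`.

(Surj) is the `π₁`-SURJECTIVITY of the restricted covering `𝒢′|_K → 𝒢|_ℍ` onto the decomposition
stabilizer, i.e. the statement that `ψ^*` followed by base change along the section is fully faithful on
`B(𝒢_ℍ)_{/Z}` — the rigidity / uniqueness-of-coverings content of [SemiAnbd] p. 30 ("`ℋ′` injects into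
`𝒢′`") which «local ∧ global ∧ vertex-aligned» does not supply formally (it holds for print's
constructed covering: (RS) `BObj.restrict_isGlobalCoveringOf`, abc-iut-L3-d3, and
`matchedStabilizers_coveringHomCan`).  Note that the vertex-alignment hypothesis of (D3) is not used by
the reduction.  Honest framing: typed ≠ proved for (Surj); nothing here takes a side on [IUTchIII]
Cor. 3.12.
-/

namespace Literature.AnabelianGeometry.SemiGraphs

namespace SemiGraphOfAnabelioids

open CategoryTheory CategoryTheory.Functor CategoryTheory.PreGaloisCategory
open Literature.AnabelianGeometry.Anabelioids
open scoped Pointwise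

universe v₁ u₁ u

variable {𝒢 𝒢' : SemiGraphOfAnabelioids.{v₁, u₁, u}}

/-- **The bridge as an inclusion of stabilizers** ([SemiAnbd] p. 30 with Rem. 2.2.1 p. 24): for any
morphism `φ : 𝒢′ → 𝒢`, sub-semi-graphs `K ⊆ 𝔾′`, `ℍ ⊆ 𝔾` with `φ(K) ⊆ ℍ`, a vertex `w ∈ K` over
`u := φ w`, constituent basepoints `(F′, F, e)` and an object `A` of `B(𝒢)`: if the decomposition group
`ι(Π_{𝒢′}) ⊆ Π_𝒢` fixes a point `x` of the fibre `F(A_u)`, then the image `ι_ψ(Π_K) ⊆ Π_ℍ` of the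
restricted morphism `ψ := φ|_K : 𝒢′|_K → 𝒢|_ℍ` fixes `x` (read in the fibre of `A|_ℍ`, which is the same
set). [cite: MochizukiSemiAnbd2006, Cor. 2.7(i) p.30] -/
theorem Hom.range_restrict_le_stabilizer_of_range_le (φ : Hom 𝒢' 𝒢) (K : 𝒢'.graph.Subgraph)
    (H : 𝒢.graph.Subgraph) (hV : K.verts ⊆ φ.base.vertexMap ⁻¹' H.verts)
    (hE : K.edges ⊆ φ.base.edgeMap ⁻¹' H.edges) (w : K.toSemiGraph.Vertex)
    (F' : 𝒢'.V w.1 ⥤ FintypeCat.{v₁}) (F : 𝒢.V (φ.base.vertexMap w.1) ⥤ FintypeCat.{v₁})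
    (e : (φ.φV w.1).pullback ⋙ F' ≅ F) (A : 𝒢.BObj) (x : (𝒢.ρ (φ.base.vertexMap w.1) ⋙ F).obj A)
    (hx : ((Aut.autMulEquivOfIso (isoWhiskerLeft (𝒢.ρ (φ.base.vertexMap w.1)) e)).toMonoidHom.comp
        (pi1Map φ.pullbackFunctor (𝒢'.ρ w.1 ⋙ F'))).range ≤
      MulAction.stabilizer (𝒢.Pi (φ.base.vertexMap w.1) F) x) :
    ((Aut.autMulEquivOfIso
          (isoWhiskerLeft ((𝒢.restrict H).ρ ⟨φ.base.vertexMap w.1, hV w.2⟩) e)).toMonoidHom.comp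
        (pi1Map (φ.restrict K H hV hE).pullbackFunctor ((𝒢'.restrict K).ρ w ⋙ F'))).range ≤
      MulAction.stabilizer (𝒢.PiH H ⟨φ.base.vertexMap w.1, hV w.2⟩ F)
        (show ((𝒢.restrict H).ρ ⟨φ.base.vertexMap w.1, hV w.2⟩ ⋙ F).obj
          ((𝒢.restrictFunctor H).obj A) from x) := by
  rintro _ ⟨σ, rfl⟩
  rw [MulAction.mem_stabilizer_iff]
  -- the bridge, pointwise: `Π_ℍ → Π_𝒢` applied to `ι_ψ σ` is `ι` applied to the image of `σ` in `Π_{𝒢′}`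
  have key : 𝒢.piHToPi H ⟨φ.base.vertexMap w.1, hV w.2⟩ F
      ((Aut.autMulEquivOfIso
          (isoWhiskerLeft ((𝒢.restrict H).ρ ⟨φ.base.vertexMap w.1, hV w.2⟩) e))
        (pi1Map (φ.restrict K H hV hE).pullbackFunctor ((𝒢'.restrict K).ρ w ⋙ F') σ)) =
      (Aut.autMulEquivOfIso (isoWhiskerLeft (𝒢.ρ (φ.base.vertexMap w.1)) e))
        (pi1Map φ.pullbackFunctor (𝒢'.ρ w.1 ⋙ F') (𝒢'.piHToPi K w F' σ)) := by
    have h1 := DFunLike.congr_fun (φ.pi1Map_pullbackFunctor_comp_piHToPi K H hV hE w F') σ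
    simp only [MonoidHom.coe_comp, Function.comp_apply] at h1
    rw [h1]
    exact (𝒢.autMulEquivOfIso_piHToPi H ⟨φ.base.vertexMap w.1, hV w.2⟩ e _).symm
  -- `ι` of anything fixes `x`
  have hfix : (Aut.autMulEquivOfIso (isoWhiskerLeft (𝒢.ρ (φ.base.vertexMap w.1)) e))
        (pi1Map φ.pullbackFunctor (𝒢'.ρ w.1 ⋙ F') (𝒢'.piHToPi K w F' σ)) • x = x :=
    MulAction.mem_stabilizer_iff.mp (hx ⟨𝒢'.piHToPi K w F' σ, rfl⟩)
  -- `Π_ℍ` acts on the fibre of `A|_ℍ` through `Π_ℍ → Π_𝒢` (definitionally)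
  rw [← key] at hfix
  exact hfix

/-- **(D3) for an ABSTRACT covering from the `π₁`-surjectivity of its restrictions.**  ASSUME (Surj):
for every connected `𝒢`, `𝒢′`, every `φ : 𝒢′ → 𝒢` which is locally (`IsFiniteEtaleCoveringOf`) and
globally (`IsGlobalCoveringOf`) the covering attached to `A` and vertex-aligned, every connected
sub-graph `ℍ`, preimage component `K`, vertex `w″ ∈ K` over `u`, constituent basepoints `(F″, F₂, e₂)`,
and every point `x` of the fibre `F₂(A_u)` FIXED by the decomposition group `ι″(Π_{𝒢′})`, the
stabilizer `Stab_{Π_ℍ}(x)` is contained in the image `ι_ψ(Π_K)` of the restricted morphism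
`ψ := φ|_K : 𝒢′|_K → 𝒢|_ℍ`.  THEN the dictionary item (D3) `covering_subgraphComponents_doubleCosets`
holds.  (The matching point is the section point of `covering_decompositionGroup_of_isGlobalCoveringOf`;
the reverse inclusion is `Hom.range_restrict_le_stabilizer_of_range_le`; then
`covering_subgraphComponents_doubleCosets_of_stabilizers`.)
[cite: MochizukiSemiAnbd2006, Cor. 2.7(i) p.30] -/
theorem covering_subgraphComponents_doubleCosets_of_restrictSurjective
    (hSurj : ∀ (𝒢 𝒢' : SemiGraphOfAnabelioids.{v₁, u₁, u}) (φ : Hom 𝒢' 𝒢) (A : 𝒢.BObj),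
      𝒢.IsConnected → 𝒢'.IsConnected → φ.IsFiniteEtaleCoveringOf A → φ.IsGlobalCoveringOf A →
      φ.IsVertexAligned →
      ∀ (H : 𝒢.graph.Subgraph), H.toSemiGraph.IsConnected → H.toSemiGraph.IsGraph →
      ∀ (K : {K : 𝒢'.graph.Subgraph // φ.IsPreimageComponent H K})
        (w'' : K.1.toSemiGraph.Vertex) (F'' : 𝒢'.V w''.1 ⥤ FintypeCat.{v₁}) [FiberFunctor F'']
        (F₂ : 𝒢.V (φ.base.vertexMap w''.1) ⥤ FintypeCat.{v₁}) [FiberFunctor F₂]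
        (e₂ : (φ.φV w''.1).pullback ⋙ F'' ≅ F₂)
        (x : (𝒢.ρ (φ.base.vertexMap w''.1) ⋙ F₂).obj A),
        ((Aut.autMulEquivOfIso (isoWhiskerLeft (𝒢.ρ (φ.base.vertexMap w''.1)) e₂)
              ).toMonoidHom.comp (pi1Map φ.pullbackFunctor (𝒢'.ρ w''.1 ⋙ F''))).range ≤
            MulAction.stabilizer (𝒢.Pi (φ.base.vertexMap w''.1) F₂) x →
        MulAction.stabilizer (𝒢.PiH H ⟨φ.base.vertexMap w''.1, K.2.2.2.2.1 w''.2⟩ F₂)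
            (show ((𝒢.restrict H).ρ ⟨φ.base.vertexMap w''.1, K.2.2.2.2.1 w''.2⟩ ⋙ F₂).obj
              ((𝒢.restrictFunctor H).obj A) from x) ≤
          ((Aut.autMulEquivOfIso
                (isoWhiskerLeft ((𝒢.restrict H).ρ ⟨φ.base.vertexMap w''.1, K.2.2.2.2.1 w''.2⟩)
                  e₂)).toMonoidHom.comp
              (pi1Map (φ.restrict K.1 H K.2.2.2.2.1 K.2.2.2.2.2.1).pullbackFunctor
                ((𝒢'.restrict K.1).ρ w'' ⋙ F''))).range) :
    covering_subgraphComponents_doubleCosets.{v₁, u₁, u} := by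
  refine covering_subgraphComponents_doubleCosets_of_stabilizers ?_
  intro 𝒢 𝒢' φ A h𝒢 h𝒢' hloc hB hal H hH hHg K w'' F'' _ F₂ _ e₂
  -- the section point of the global clause: `ι″(Π_{𝒢′}) = Stab(x₀)`
  obtain ⟨x₀, -, hx₀⟩ := covering_decompositionGroup_of_isGlobalCoveringOf φ A hB w''.1 F'' F₂ e₂
  refine ⟨x₀, le_antisymm ?_ ?_, hx₀⟩
  · exact φ.range_restrict_le_stabilizer_of_range_le K.1 H K.2.2.2.2.1 K.2.2.2.2.2.1 w'' F'' F₂ e₂ A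
      x₀ hx₀.le
  · exact hSurj 𝒢 𝒢' φ A h𝒢 h𝒢' hloc hB hal H hH hHg K w'' F'' F₂ e₂ x₀ hx₀.le

end SemiGraphOfAnabelioids

end Literature.AnabelianGeometry.SemiGraphs
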